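import Summits.Parity.GeneralizedHardyLittlewood.Theses.LeeYangFibres
import Summits.Parity.GeneralizedHardyLittlewood.Theorems.LeeYangFibresModelHyperbolicityDefs

/-!
# Sketch — crux-ideate stmt-Parity-18103 (`LeeYangFibres.FibreHyperbolicityAlong`), ideator 2, round 1

First-lemma signatures of the two idea cards (statements only; nothing is asserted):

* Card `exceptional-zero-resonance`: `ParitySplitCertificate` (combinatorial), `SiegelQualityBound`,
  `ResonanceNecessity : FibreHyperbolicityAlong → quality of Siegel zeros ≤ C log log q eventually`.
* Card `dickman-dictionary-unit-gaps`: `Separated`, `GapsMonotone`, `ModelUnitGaps` (Conjecture G),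
  `MarginFromGaps` (elementary robustness lemma), `DickmanDictionaryOne/Two` (the dimension-κ Dickman
  identities at `z = -1, -2`), `FlatFibreHyperbolicityAlong` and `FibreHyperbolicityAlongOne` (the two
  parity-free slices of the crux this line would close).
-/

noncomputable section

namespace Summit.Parity.GeneralizedHardyLittlewood.Cruxes.FibreHyperbolicityAlong.Ideator2

open scoped BigOperators Classical
open Polynomial
open Summit.Parity.GeneralizedHardyLittlewood.Theses.LeeYangFibres (FibreHyperbolicityAlong)
open Summit.Parity.GeneralizedHardyLittlewood.Cruxes.ModelHyperbolicity.WindowChainTransport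
  (cellDensity modelPoly modelEval)

/-! ## Card 1 — exceptional-zero resonance (necessity + guard) -/

/-- Log-concavity with no internal zeros of a non-negative sequence on `[0, d]` — the consequence of
real-rootedness with non-negative coefficients (Newton; tree: `HyperbolicityClipsParity.newton_filter_sum_sq`). -/
def LogConcaveNoInternalZeros (p : ℕ → ℝ) (d : ℕ) : Prop :=
  (∀ m, 1 ≤ m → m + 1 ≤ d → p (m - 1) * p (m + 1) ≤ p m ^ 2) ∧
  (∀ a b c, a < b → b < c → c ≤ d → 0 < p a → 0 < p c → 0 < p b)

/-- FIRST LEMMA (combinatorial parity certificate): if every EVEN-index coefficient is `≤ δ` while two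
ODD-index coefficients exceed `δ`, the sequence is not log-concave-without-internal-zeros (between two odd
indices there is an even one, and log-concavity forces `p b ≥ min (p a) (p c)` for `a ≤ b ≤ c`). -/
def ParitySplitCertificate : Prop :=
  ∀ (p : ℕ → ℝ) (d : ℕ) (δ : ℝ), (∀ m, 0 ≤ p m) →
    (∀ m, m ≤ d → Even m → p m ≤ δ) →
    (∃ a c, a < c ∧ c ≤ d ∧ Odd a ∧ Odd c ∧ δ < p a ∧ δ < p c) →
      ¬ LogConcaveNoInternalZeros p d

/-- A bound `g q` on the QUALITY of Siegel zeros at large conductors `q` (square-free, `q ≡ 3 (mod 4)`, the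
conductors of the tree's `TaoTeravainen2021_prop35`): no real zero `1 - 1/(η log q)` with `η ≥ g q`. -/
def SiegelQualityBound (g : ℕ → ℝ) : Prop :=
  ∃ q₀ : ℝ, ∀ (q : ℕ) [NeZero q], Squarefree q → q % 4 = 3 → q₀ ≤ (q : ℝ) →
    ∀ χ : DirichletCharacter ℂ q, χ.IsPrimitive → χ.IsQuadratic →
      ∀ η : ℝ, g q ≤ η → χ.LFunction ((1 - 1 / (η * Real.log q) : ℝ) : ℂ) ≠ 0

/-- NECESSITY THEOREM (target of the card; modulo the vendored Matomäki–Merikoski Theorem 1.3 and a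
Gallagher-type prime number theorem with exceptional term, to be vendored): the crux bounds the quality of
Siegel zeros by `C log log q` at large conductors. -/
def ResonanceNecessity : Prop :=
  FibreHyperbolicityAlong →
    ∃ C : ℝ, 0 < C ∧ SiegelQualityBound (fun q => C * Real.log (Real.log (q : ℝ)))

/-! ## Card 2 — dimension-κ Dickman dictionary, monotone unit gaps, exponential margin -/

/-- Pairwise root separation `≥ g` (equivalent to: consecutive gaps `≥ g`). -/
def Separated (g : ℝ) (P : ℝ[X]) : Prop :=
  ∀ r ∈ P.roots, ∀ r' ∈ P.roots, r ≠ r' → g ≤ |r - r'|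

/-- Gaps are non-increasing along the ascending list of roots (the most negative roots are the most spread):
with `L = sort P.roots`, `L[i+1] - L[i] ≥ L[i+2] - L[i+1]`. -/
def GapsMonotone (P : ℝ[X]) : Prop :=
  let L := P.roots.sort (· ≤ ·)
  ∀ i : ℕ, i + 2 < L.length → L.getD (i + 2) 0 - L.getD (i + 1) 0 ≤ L.getD (i + 1) 0 - L.getD i 0

/-- CONJECTURE G (model row, every integer roughness `u ≥ 4`): the `u - 2` negative zeros of
`modelPoly u = Σ_{j<u} I_{j+1}(u) X^j` are pairwise `≥ 1` apart and their gaps are monotone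
(numerics of this seat: `u ∈ [4, 31]` step `1/10`, 0 violations; first gap `→ 1⁺`). -/
def ModelUnitGaps : Prop :=
  ∀ u : ℕ, 4 ≤ u → Separated 1 (modelPoly u) ∧ GapsMonotone (modelPoly u)

/-- Coefficientwise RELATIVE perturbation of size `θ`. -/
def RelPerturb (P Q : ℝ[X]) (θ : ℝ) : Prop :=
  ∀ n, |Q.coeff n - P.coeff n| ≤ θ * |P.coeff n|

/-- MARGIN FROM GAPS (elementary robustness lemma): a real-rooted polynomial with non-negative coefficients,
negative zeros pairwise `≥ 1/2` apart with monotone gaps keeps all its zeros real under every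
coefficientwise relative perturbation of size `exp(-C · deg)`. -/
def MarginFromGaps : Prop :=
  ∃ C : ℝ, 0 < C ∧ ∀ P : ℝ[X], (∀ n, 0 ≤ P.coeff n) → 0 < P.coeff 0 →
    P.roots.card = P.natDegree → (∀ r ∈ P.roots, r < 0) → Separated (1 / 2) P → GapsMonotone P →
      ∀ Q : ℝ[X], Q.natDegree ≤ P.natDegree →
        RelPerturb P Q (Real.exp (-C * P.natDegree)) → Q.roots.card = Q.natDegree ∧ Q.natDegree = P.natDegree

/-- DICKMAN DICTIONARY at `z = -1` (classical: Alladi's duality, the alternating Buchstab function is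
`-ρ(u-1)/u`): for the Dickman function `ρ` (continuous, `= 1` on `[0,1]`, `u ρ'(u) = -ρ(u-1)` for `u > 1`),
`Σ_{j<u} I_{j+1}(u) (-1)^j = ρ(u-1)` at integer `u ≥ 2`. -/
def DickmanDictionaryOne : Prop :=
  ∀ ρ : ℝ → ℝ, Continuous ρ → (∀ u, u ≤ 1 → ρ u = 1) →
    (∀ u : ℝ, 1 < u → HasDerivAt ρ (-ρ (u - 1) / u) u) →
      ∀ u : ℕ, 2 ≤ u → modelEval u u (-1) = (ρ ((u : ℝ) - 1) : ℂ)

/-- DICKMAN DICTIONARY at `z = -2` (new; numerically exact to 6 digits at `u = 6, 8, 10, 12`): for the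
dimension-2 Dickman function `ρ₂ = ρ ⋆ ρ` (`ρ₂(u) = u` on `[0,1]`, `u ρ₂'(u) = ρ₂(u) - 2ρ₂(u-1)` for
`u > 1`), `Σ_{j<u} I_{j+1}(u) (-2)^j = ρ₂'(u-1)` at integer `u ≥ 3`.  Conjectured pattern:
`Σ_j I_{j+1}(u)(-k)^j = ρ_k^{(k-1)}(u-1)` with `ρ_k = ρ^{⋆k}`. -/
def DickmanDictionaryTwo : Prop :=
  ∀ ρ₂ : ℝ → ℝ, Continuous ρ₂ → (∀ u, 0 ≤ u → u ≤ 1 → ρ₂ u = u) →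
    (∀ u : ℝ, 1 < u → HasDerivAt ρ₂ ((ρ₂ u - 2 * ρ₂ (u - 1)) / u) u) →
      ∀ u : ℕ, 3 ≤ u → modelEval u u (-2) = ((deriv ρ₂ ((u : ℝ) - 1) : ℝ) : ℂ)

/-- The FLAT slice of the crux along the schedule (all frozen fugacities `= 1`), every `t` — parity-free,
the first deliverable of the line. -/
def FlatFibreHyperbolicityAlong : Prop :=
  ∀ (t L : ℕ), 1 ≤ t → ∀ η : ℝ, 0 < η → ∃ N₀ : ℕ, ∀ N : ℕ, N₀ ≤ N →
    ∀ Ψ : Fin t → Literature.NumberTheory.Sieve.AffLinForm 1,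
      Literature.NumberTheory.Sieve.IsNondegenerateSystem Ψ →
      Literature.NumberTheory.Sieve.affLinSize Ψ N ≤ L → ∀ K : Set (Fin 1 → ℝ), Convex ℝ K →
      K ⊆ Literature.NumberTheory.Sieve.realBox 1 N →
      η * (N : ℝ) ≤ Literature.NumberTheory.Sieve.archFactor Ψ K *
        Literature.NumberTheory.Sieve.singularProduct Ψ →
      ∀ i : Fin t, ∀ ζ : ℂ,
        (∑ j ∈ Fintype.piFinset
            (fun _ : Fin t => Finset.Icc 1 (max 4 ⌊Real.sqrt (Real.log (Real.log N)) / 2⌋₊)),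
          ((((Literature.NumberTheory.Sieve.latticeBox 1 N).filter (fun n =>
              Literature.NumberTheory.Sieve.realPoint n ∈ K ∧ ∀ k,
                (N : ℝ) ^ ((1 : ℝ) / (max 4 ⌊Real.sqrt (Real.log (Real.log N)) / 2⌋₊ : ℕ)) <
                  (Nat.minFac ((Ψ k).eval n).toNat : ℝ) ∧
                ArithmeticFunction.cardFactors ((Ψ k).eval n).toNat = j k)).card : ℕ) : ℂ) *
            ζ ^ (j i)) = 0 → ζ.im = 0

/-- The `t = 1` case of the crux (no frozen fugacities: it IS the flat slice at `t = 1`) — the second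
deliverable; listed open by the crux-attack refuter ("needs quantitative zero spacing of F_u for all u"). -/
def FibreHyperbolicityAlongOne : Prop :=
  ∀ L : ℕ, ∀ η : ℝ, 0 < η → ∃ N₀ : ℕ, ∀ N : ℕ, N₀ ≤ N →
    ∀ Ψ : Fin 1 → Literature.NumberTheory.Sieve.AffLinForm 1,
      Literature.NumberTheory.Sieve.IsNondegenerateSystem Ψ →
      Literature.NumberTheory.Sieve.affLinSize Ψ N ≤ L → ∀ K : Set (Fin 1 → ℝ), Convex ℝ K →
      K ⊆ Literature.NumberTheory.Sieve.realBox 1 N →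
      η * (N : ℝ) ≤ Literature.NumberTheory.Sieve.archFactor Ψ K *
        Literature.NumberTheory.Sieve.singularProduct Ψ →
      ∀ w : Fin 1 → ℝ, (∀ k, 0 < w k ∧ w k ≤ 1) → ∀ ζ : ℂ,
        (∑ j ∈ Fintype.piFinset
            (fun _ : Fin 1 => Finset.Icc 1 (max 4 ⌊Real.sqrt (Real.log (Real.log N)) / 2⌋₊)),
          ((((Literature.NumberTheory.Sieve.latticeBox 1 N).filter (fun n =>
              Literature.NumberTheory.Sieve.realPoint n ∈ K ∧ ∀ k,
                (N : ℝ) ^ ((1 : ℝ) / (max 4 ⌊Real.sqrt (Real.log (Real.log N)) / 2⌋₊ : ℕ)) <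
                  (Nat.minFac ((Ψ k).eval n).toNat : ℝ) ∧
                ArithmeticFunction.cardFactors ((Ψ k).eval n).toNat = j k)).card : ℕ) : ℂ) *
            ∏ k, (if k = (0 : Fin 1) then ζ else ((w k : ℝ) : ℂ)) ^ (j k)) = 0 → ζ.im = 0

/-- Sanity: the `t = 1` slice is literally the `t = 1` instance of the crux. -/
theorem fibreHyperbolicityAlongOne_of (h : FibreHyperbolicityAlong) : FibreHyperbolicityAlongOne := by
  intro L η hη
  obtain ⟨N₀, hN₀⟩ := h 1 L le_rfl η hη
  refine ⟨N₀, fun N hN Ψ hΨ hL K hK hKN hm w hw ζ hζ => ?_⟩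
  exact hN₀ N hN Ψ hΨ hL K hK hKN hm 0 w hw ζ hζ

end Summit.Parity.GeneralizedHardyLittlewood.Cruxes.FibreHyperbolicityAlong.Ideator2

end
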